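import Summits.RiemannHypothesis.RiemannHypothesis.Theorems.Splittings.LiIncrEnvelopeWindow
import HarnessLib

/-!
# THE RE-PHASING KIT: alignment, no-drift for finite phase families, stride selection — PURE (SketchG15B §§A–C)

PRE-CUT (not filed; rides as a third (xi-o) file ONLY at the lead's discretion per referee g8's carve word 16:10:24Z):
cell rh-split, seat rh-split-li-bridge g15 (brief sha16 f79c5f09d8bcb036), card `run/shared/lean/pub/rh-split/cards/SPLIT-li-bridge.md`
§22.7; kernel source `HOME/rh-split-li-bridge/SketchG15B.lean` sha16 8a3bf5ccaf362c82 (170 l, 0 defs, 10 theorems, farm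
rc 0 · 0 err · 0 warn · 0 sorry, std axioms; referee REPLAY PASS 16:10:24Z), §§A–C, decl text byte-verbatim; deltas = namespace
`RhSplit.LiBridgeG15B` ↦ `…Theorems.Splittings.LiRephasingKit`, this header, `set_option linter.dupNamespace false`, and ONE cosmetic
docstring word dropped («non-negative» in `sum_le_mul_sum_stride`, unused — referee note).  Zero definitions.

Content (the two mechanisms of the card's MODEL BARRIER THEOREM A, 22.2, as PURE lemmas): §A ALIGNMENT — `exists_sin_eq_neg_one_of_phase_drop`
(IVT: a continuous phase dropping by `2π` passes a point where `sin = −1`), `exists_realign` / `exists_realign_sq` (with the tree's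
`LiLowZeroBudget.phase_sub_ge`: any ordinate `x ≥ 1` with `16πx ≤ n+½` moves up by `≤ 16πx²/(n+½)` to make `sin((n+½)θ(x')) = −1`);
§B NO DRIFT — `abs_sum_range_family_le`: `|Σ_{i<M} Σ_{a∈S} w_a · 4 sin(θ_a/2) sin((N+i+½)θ_a)| ≤ 4 Σ_{a∈S} w_a` for any finite family
with weights `≥ 0` and arbitrary phases; §C SELECTION — `sum_le_mul_sum_stride` (every `m`-th term of an antitone sequence carries `≥ 1/m`
of the mass), `exists_le_on_block`.

HONEST LABEL: SPLITTING SEARCH over kernel-typed RH-EQUIVALENCES; a splitting A ∧ B ⟹ RH is CONDITIONAL bookkeeping unless A and B are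
both proved; nothing here bears on the truth of RH.  Every theorem below is PURE (real analysis / finite sums); none mentions `ζ` or RH.
-/

set_option linter.dupNamespace false

namespace Summit.RiemannHypothesis.RiemannHypothesis.Theorems.Splittings.LiRephasingKit


open Real Set Finset
open Summit.RiemannHypothesis.RiemannHypothesis.Theorems.LiTheory
open Summit.RiemannHypothesis.RiemannHypothesis.Theorems.Splittings

/-! ## §A Alignment -/

/-- IVT: a continuous phase that DROPS by at least `2π` across `[a, b]` takes a value where `sin = −1`. PURE. -/
theorem exists_sin_eq_neg_one_of_phase_drop {φ : ℝ → ℝ} {a b : ℝ} (hab : a ≤ b)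
    (hφ : ContinuousOn φ (Icc a b)) (hdrop : φ b + 2 * π ≤ φ a) :
    ∃ t ∈ Icc a b, Real.sin (φ t) = -1 := by
  have hπ : 0 < 2 * π := by positivity
  set q : ℝ := (φ b - 3 * π / 2) / (2 * π) with hq
  set k : ℤ := ⌈q⌉ with hk
  set y : ℝ := 3 * π / 2 + (k : ℝ) * (2 * π) with hy
  have hk1 : q ≤ k := Int.le_ceil _
  have hk2 : (k : ℝ) < q + 1 := Int.ceil_lt_add_one _
  have hq1 : q * (2 * π) = φ b - 3 * π / 2 := by rw [hq]; field_simp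
  have hy1 : φ b ≤ y := by
    have h := mul_le_mul_of_nonneg_right hk1 hπ.le
    rw [hq1] at h; rw [hy]; linarith
  have hy2 : y ≤ φ a := by
    have h := mul_lt_mul_of_pos_right hk2 hπ
    rw [add_mul, hq1, one_mul] at h; rw [hy]; linarith
  obtain ⟨t, ht, hφt⟩ := intermediate_value_Icc' hab hφ ⟨hy1, hy2⟩
  refine ⟨t, ht, ?_⟩
  rw [hφt, hy, Real.sin_add_int_mul_two_pi,
    show (3 : ℝ) * π / 2 = π / 2 + π by ring, Real.sin_add_pi, Real.sin_pi_div_two]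

/-- **ALIGNMENT LEMMA for the Li phase.** If `1 ≤ x`, `0 < d` and `4π (x+d)² ≤ (n+½) d`, then some `x' ∈ [x, x+d]` has
`sin((n+½)·θ(x')) = −1` (`θ = liZeroAngle`): moving an ordinate by at most `d` realigns its increment term to minus its
full amplitude.  (Uses the tree's `LiLowZeroBudget.phase_sub_ge`; the card's two-sided version has `π(x²+¼)` in
place of `4π(x+d)²`.) PURE. -/
theorem exists_realign {x d : ℝ} (n : ℕ) (hx : 1 ≤ x) (hd : 0 < d)
    (hreach : 4 * π * (x + d) ^ 2 ≤ ((n : ℝ) + 1 / 2) * d) :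
    ∃ x' ∈ Icc x (x + d), Real.sin (((n : ℝ) + 1 / 2) * liZeroAngle x') = -1 := by
  refine exists_sin_eq_neg_one_of_phase_drop (φ := fun t ↦ ((n : ℝ) + 1 / 2) * liZeroAngle t)
    (by linarith) ?_ ?_
  · intro t ht
    have ht0 : t ≠ 0 := by linarith [ht.1]
    exact (continuousWithinAt_const.mul
      (hasDerivAt_liZeroAngle ht0).continuousAt.continuousWithinAt)
  · have h1 := LiLowZeroBudget.phase_sub_ge hx (by linarith : x < x + d)
    have hxd : 0 < x + d := by linarith
    have h2 : 2 * π ≤ ((n : ℝ) + 1 / 2) * ((x + d - x) / (2 * (x + d) ^ 2)) := by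
      rw [show x + d - x = d by ring, mul_div_assoc', le_div_iff₀ (by positivity)]
      nlinarith [hreach]
    have hn : (0 : ℝ) ≤ (n : ℝ) + 1 / 2 := by positivity
    have h3 := mul_le_mul_of_nonneg_left h1 hn
    show ((n : ℝ) + 1 / 2) * liZeroAngle (x + d) + 2 * π ≤ ((n : ℝ) + 1 / 2) * liZeroAngle x
    nlinarith [h2, h3]

/-- The reachability condition in the regime of the card: if `x + d ≤ 2x` and `16π x² ≤ (n+½) d` then
`4π(x+d)² ≤ (n+½)d`; e.g. `d = 16π x²/(n+½)`, which is `≤ x` as soon as `16π x ≤ n + ½`, and is at most a quarter of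
the mean spacing `2π/log x` as soon as `32 x² log x ≤ n + ½` — the DECORRELATED zone `x ≲ √(n / log n)`. PURE. -/
theorem reach_of_sq (x d : ℝ) (n : ℕ) (hdx : x + d ≤ 2 * x) (hxd : 0 ≤ x + d)
    (h : 16 * π * x ^ 2 ≤ ((n : ℝ) + 1 / 2) * d) : 4 * π * (x + d) ^ 2 ≤ ((n : ℝ) + 1 / 2) * d := by
  have h1 : (x + d) ^ 2 ≤ (2 * x) ^ 2 := pow_le_pow_left₀ hxd hdx 2
  nlinarith [h1, Real.pi_pos]

/-- **ALIGNMENT IN THE DECORRELATED ZONE:** for `1 ≤ x` and `16π x ≤ n + ½` there is `x'` with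
`x ≤ x' ≤ x + 16π x²/(n+½)` and `sin((n+½)θ(x')) = −1`. PURE. -/
theorem exists_realign_sq {x : ℝ} (n : ℕ) (hx : 1 ≤ x) (hn : 16 * π * x ≤ (n : ℝ) + 1 / 2) :
    ∃ x' : ℝ, x ≤ x' ∧ x' ≤ x + 16 * π * x ^ 2 / ((n : ℝ) + 1 / 2) ∧
      Real.sin (((n : ℝ) + 1 / 2) * liZeroAngle x') = -1 := by
  set d := 16 * π * x ^ 2 / ((n : ℝ) + 1 / 2) with hd
  have hn0 : (0 : ℝ) < (n : ℝ) + 1 / 2 := by positivity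
  have hx0 : 0 < x := by linarith
  have hdpos : 0 < d := by positivity
  have hnd : ((n : ℝ) + 1 / 2) * d = 16 * π * x ^ 2 := by rw [hd]; field_simp
  have hdx : d ≤ x := by
    rw [hd, div_le_iff₀ hn0]
    nlinarith [hn, hx0, Real.pi_pos]
  have hreach : 4 * π * (x + d) ^ 2 ≤ ((n : ℝ) + 1 / 2) * d :=
    reach_of_sq x d n (by linarith) (by linarith) (le_of_eq hnd.symm)
  obtain ⟨x', hx', hs⟩ := exists_realign n hx hdpos hreach
  exact ⟨x', hx'.1, hx'.2, hs⟩

/-! ## §B No drift for an arbitrary finite phase family -/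

/-- Product-to-sum: `4 sin(θ/2) sin((n+½)θ) = 2(cos nθ − cos (n+1)θ)`. PURE. -/
theorem four_sin_half_mul_sin (θ : ℝ) (n : ℕ) :
    4 * Real.sin (θ / 2) * Real.sin (((n : ℝ) + 1 / 2) * θ) =
      2 * (Real.cos (n * θ) - Real.cos (((n : ℝ) + 1) * θ)) := by
  rw [Real.cos_sub_cos]
  have e1 : ((n : ℝ) * θ + ((n : ℝ) + 1) * θ) / 2 = ((n : ℝ) + 1 / 2) * θ := by ring
  have e2 : ((n : ℝ) * θ - ((n : ℝ) + 1) * θ) / 2 = -(θ / 2) := by ring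
  rw [e1, e2, Real.sin_neg]; ring

/-- Telescoping over a block of `M` consecutive indices: `Σ_{i<M} 4 sin(θ/2) sin((N+i+½)θ) = 2(cos Nθ − cos (N+M)θ)`. PURE. -/
theorem sum_range_phase_telescope (θ : ℝ) (N M : ℕ) :
    ∑ i ∈ range M, 4 * Real.sin (θ / 2) * Real.sin ((((N + i : ℕ) : ℝ) + 1 / 2) * θ) =
      2 * (Real.cos (N * θ) - Real.cos (((N + M : ℕ) : ℝ) * θ)) := by
  induction M with
  | zero => simp
  | succ M ih =>
    rw [sum_range_succ, ih, four_sin_half_mul_sin]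
    push_cast; ring

/-- Hence every block sum of one phase term is bounded by `4`, uniformly in `N, M, θ`. PURE. -/
theorem abs_sum_range_phase_le (θ : ℝ) (N M : ℕ) :
    |∑ i ∈ range M, 4 * Real.sin (θ / 2) * Real.sin ((((N + i : ℕ) : ℝ) + 1 / 2) * θ)| ≤ 4 := by
  rw [sum_range_phase_telescope, abs_le]
  constructor <;> nlinarith [Real.neg_one_le_cos (N * θ), Real.cos_le_one (N * θ),
    Real.neg_one_le_cos (((N + M : ℕ) : ℝ) * θ), Real.cos_le_one (((N + M : ℕ) : ℝ) * θ)]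

/-- **NO-DRIFT LAW for an arbitrary weighted finite family of phases** (`w ≥ 0`):
`|Σ_{i<M} Σ_{a∈S} w_a · 4 sin(θ_a/2) sin((N+i+½)θ_a)| ≤ 4 Σ_{a∈S} w_a`.  Block AVERAGES over `M` consecutive `n` are
`≤ 4 Σ w / M` whatever the phases are — realignment (§A) on a sparse set of `n` is invisible to averaging. PURE. -/
theorem abs_sum_range_family_le {α : Type*} (S : Finset α) (w θ : α → ℝ) (hw : ∀ a ∈ S, 0 ≤ w a) (N M : ℕ) :
    |∑ i ∈ range M, ∑ a ∈ S, w a * (4 * Real.sin (θ a / 2) * Real.sin ((((N + i : ℕ) : ℝ) + 1 / 2) * θ a))| ≤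
      4 * ∑ a ∈ S, w a := by
  rw [sum_comm, mul_sum]
  refine (abs_sum_le_sum_abs _ _).trans (sum_le_sum fun a ha ↦ ?_)
  have e : ∑ i ∈ range M, w a * (4 * Real.sin (θ a / 2) * Real.sin ((((N + i : ℕ) : ℝ) + 1 / 2) * θ a)) =
      w a * ∑ i ∈ range M, 4 * Real.sin (θ a / 2) * Real.sin ((((N + i : ℕ) : ℝ) + 1 / 2) * θ a) :=
    (mul_sum _ _ _).symm
  rw [e, abs_mul, abs_of_nonneg (hw a ha)]
  calc w a * |∑ i ∈ range M, 4 * Real.sin (θ a / 2) * Real.sin ((((N + i : ℕ) : ℝ) + 1 / 2) * θ a)|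
      ≤ w a * 4 := mul_le_mul_of_nonneg_left (abs_sum_range_phase_le _ _ _) (hw a ha)
    _ = 4 * w a := mul_comm _ _

/-! ## §C Selection -/

/-- **GAIN step:** the every-`m`-th subsequence of an antitone sequence carries at least `1/m` of the
mass of the first `m·K` terms: `Σ_{j < mK} u j ≤ m · Σ_{i<K} u (m i)`. PURE. -/
theorem sum_le_mul_sum_stride {u : ℕ → ℝ} (hu : Antitone u) (m K : ℕ) :
    ∑ j ∈ range (m * K), u j ≤ m * ∑ i ∈ range K, u (m * i) := by
  induction K with
  | zero => simp
  | succ K ih =>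
    rw [Nat.mul_succ, sum_range_add, sum_range_succ, mul_add]
    gcongr
    calc ∑ x ∈ range m, u (m * K + x) ≤ ∑ _x ∈ range m, u (m * K) :=
          sum_le_sum fun x _ ↦ hu (Nat.le_add_right _ _)
      _ = m * u (m * K) := by rw [sum_const, card_range, nsmul_eq_mul]

/-- **AVERAGING step:** on a nonempty block some index does at most the average — if `Σ_{n∈B} f n ≤ Σ_{n∈B} g n`
then `f n ≤ g n` for some `n ∈ B` (`Finset.exists_le_of_sum_le`). PURE. -/
theorem exists_le_on_block {B : Finset ℕ} (hB : B.Nonempty) {f g : ℕ → ℝ}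
    (h : ∑ n ∈ B, f n ≤ ∑ n ∈ B, g n) : ∃ n ∈ B, f n ≤ g n :=
  Finset.exists_le_of_sum_le hB h

end Summit.RiemannHypothesis.RiemannHypothesis.Theorems.Splittings.LiRephasingKit
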